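import Summits.QuantumAdvantage.AdviceFreeQNC0.WalkTransport
import HarnessLib

/-!
# Walk-preserving segment moves for the mod-3 walk game (decomp-qadv lens-6 g17 «OrbitDial», tree part 30A)

For the game `ringWinU c y` (address of cut `g` on input `u`: `c + g + walkExp u g (mod 3)`, live iff `≠ 0`, win iff the number of
fired live cuts is odd) this file proves the SEGMENT-COMPLEMENT LAW: if the walk vanishes at cuts `i ≤ j` then complementing the bits
in `[i, j)` leaves every address outside `[i, j]` unchanged and negates (mod 3) every address inside — so EVERY cut keeps its liveness
(`SegMove.live_segCompl_iff`), the zero set is invariant, and the win bit moves by the parity of the number of live cuts whose output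
changes (`SegMove.ringWinU_segCompl_iff`); plus the abstract PAIRING LAW (`SegMove.pairing_law`: a win-flipping involution on a set `E`
of inputs forces `2·#WIN + |E| ≤ 2·2ⁿ`).  Supports item stmt-QuantumAdvantage-32604 (`CharDial.WalkHardFJLinOdd`); source: pub annex
g17/OrbitDial37.lean §37a–§37c (sha256 9083c6e4…), statements and proofs verbatim.
-/

set_option autoImplicit false

namespace Summit.QuantumAdvantage.AdviceFreeQNC0.JLinPeel.SegMove

open Finset
open Summit.QuantumAdvantage.AdviceFreeQNC0

variable {n : ℕ}

/-! ### the segment-complement move -/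

/-- complement the bits of `u` in the window `[i, j)`. -/
def segCompl (u : Fin n → Bool) (i j : ℕ) : Fin n → Bool :=
  fun t => if i ≤ t.val ∧ t.val < j then !u t else u t

/-- unfolding lemma for `segCompl`. -/
@[simp] theorem segCompl_apply (u : Fin n → Bool) (i j : ℕ) (t : Fin n) :
    segCompl u i j t = if i ≤ t.val ∧ t.val < j then !u t else u t := rfl

/-- `segCompl u i j` is an involution. -/
theorem segCompl_segCompl (u : Fin n → Bool) (i j : ℕ) : segCompl (segCompl u i j) i j = u := by
  funext t
  simp only [segCompl_apply]
  split_ifs <;> simp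

/-- outside the window the bits are unchanged. -/
theorem segCompl_of_not_mem (u : Fin n → Bool) {i j : ℕ} (t : Fin n) (ht : ¬ (i ≤ t.val ∧ t.val < j)) :
    segCompl u i j t = u t := by
  simp [segCompl_apply, ht]

/-- ones of `u` in the window `[i, k)`. -/
def wseg (u : Fin n → Bool) (i k : ℕ) : ℕ :=
  (univ.filter fun t : Fin n => (i ≤ t.val ∧ t.val < k) ∧ u t = true).card

/-- the number of positions in the window `[i, k)` (`k ≤ n`). -/
theorem card_window {i k : ℕ} (hk : k ≤ n) :
    (univ.filter fun t : Fin n => i ≤ t.val ∧ t.val < k).card = k - i := by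
  have h1 : (univ.filter fun t : Fin n => i ≤ t.val ∧ t.val < k)
      = (univ.filter fun t : Fin n => t.val < k) \ (univ.filter fun t : Fin n => t.val < i) := by
    ext t
    simp only [mem_filter, mem_univ, true_and, mem_sdiff, not_lt]
    tauto
  have hsub : (univ.filter fun t : Fin n => t.val < i) ∩ (univ.filter fun t : Fin n => t.val < k)
      = univ.filter fun t : Fin n => t.val < min i k := by
    ext t; simp only [mem_inter, mem_filter, mem_univ, true_and, lt_min_iff]
  rw [h1, card_sdiff, hsub, Fin.card_filter_val_lt, Fin.card_filter_val_lt]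
  simp only [Nat.min_def]
  split_ifs <;> omega

/-- pointwise bookkeeping identity behind all the weight lemmas (`g` = the cut, `k = min g j`). -/
theorem pointwise_identity (u : Fin n → Bool) (i j g : ℕ) (t : Fin n) :
    ((if segCompl u i j t = true then 1 else 0) + (if t.val < g ∧ segCompl u i j t = true then 1 else 0)
      + 2 * (if (i ≤ t.val ∧ t.val < j) ∧ u t = true then 1 else 0)
      + 2 * (if (i ≤ t.val ∧ t.val < min g j) ∧ u t = true then 1 else 0) : ℕ)
    = (if u t = true then 1 else 0) + (if t.val < g ∧ u t = true then 1 else 0)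
      + (if i ≤ t.val ∧ t.val < j then 1 else 0) + (if i ≤ t.val ∧ t.val < min g j then 1 else 0) := by
  simp only [segCompl_apply, lt_min_iff]
  rcases Bool.eq_false_or_eq_true (u t) with hut | hut <;>
    by_cases hw : i ≤ t.val ∧ t.val < j <;> by_cases hg : t.val < g <;> simp [hw, hg, hut]

/-- **weight bookkeeping.** `walkExp u' g + 2·w[i,j) + 2·w[i, min g j) = walkExp u g + (j − i) + (min g j − i)` for `j ≤ n` (truncated subtraction; used with `i ≤ j`). -/
theorem walkExp_segCompl (u : Fin n → Bool) {i j : ℕ} (hj : j ≤ n) (g : ℕ) :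
    walkExp (segCompl u i j) g + 2 * wseg u i j + 2 * wseg u i (min g j)
      = walkExp u g + (j - i) + (min g j - i) := by
  unfold walkExp wt wtPrefix wseg
  simp only [card_filter]
  rw [mul_sum, mul_sum, ← sum_add_distrib, ← sum_add_distrib, ← sum_add_distrib,
    ← card_window (i := i) hj, ← card_window (i := i) ((min_le_right g j).trans hj), card_filter, card_filter,
    ← sum_add_distrib, ← sum_add_distrib, ← sum_add_distrib]
  exact sum_congr rfl fun t _ => pointwise_identity u i j g t

/-- the walk from a cut `i` to a later cut `g`: `walkExp u g = walkExp u i + w[i, g)`. -/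
theorem walkExp_add_wseg (u : Fin n → Bool) {i g : ℕ} (hig : i ≤ g) :
    walkExp u g = walkExp u i + wseg u i g := by
  unfold walkExp wtPrefix wseg
  have : (univ.filter fun t : Fin n => t.val < g ∧ u t = true)
      = (univ.filter fun t : Fin n => t.val < i ∧ u t = true) ∪
        (univ.filter fun t : Fin n => (i ≤ t.val ∧ t.val < g) ∧ u t = true) := by
    ext t; simp only [mem_filter, mem_univ, true_and, mem_union]
    constructor
    · rintro ⟨h1, h2⟩
      by_cases h : t.val < i
      · exact Or.inl ⟨h, h2⟩
      · exact Or.inr ⟨⟨not_lt.mp h, h1⟩, h2⟩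
    · rintro (⟨h1, h2⟩ | ⟨⟨h1, h2⟩, h3⟩)
      · exact ⟨lt_of_lt_of_le h1 hig, h2⟩
      · exact ⟨h2, h3⟩
  rw [this, card_union_of_disjoint]
  · ring
  · rw [disjoint_filter]
    intro t _ h1 h2
    exact absurd h1.1 (not_lt.mpr h2.1.1)

/-! ### LAW: liveness is invariant under a zero-to-zero segment complement -/

/-- the address of cut `g` on input `u` at charge `c`, mod 3 (`0` = dead). -/
def addr (c : ℕ) (u : Fin n → Bool) (g : ℕ) : ℕ := (c + g + walkExp u g) % 3

/-- unfolding lemma for `addr`. -/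
theorem addr_eq (c : ℕ) (u : Fin n → Bool) (g : ℕ) : addr c u g = (c + g + walkExp u g) % 3 := rfl

/-- **LAW (outside).** for `g ≤ i` or `j ≤ g` the address is unchanged. -/
theorem addr_segCompl_outside (c : ℕ) (u : Fin n → Bool) {i j : ℕ} (hij : i ≤ j) (hj : j ≤ n)
    (hzi : addr c u i = 0) (hzj : addr c u j = 0) {g : ℕ} (hg : g ≤ i ∨ j ≤ g) :
    addr c (segCompl u i j) g = addr c u g := by
  have hb := walkExp_segCompl u (i := i) hj g
  have hw := walkExp_add_wseg u hij
  unfold addr at *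
  rcases hg with hg | hg
  · have hmin : min g j = g := min_eq_left (hg.trans hij)
    rw [hmin, Nat.sub_eq_zero_of_le hg] at hb
    have hw0 : wseg u i g = 0 := by
      unfold wseg; rw [card_eq_zero, filter_eq_empty_iff]
      intro t _ h; exact absurd (lt_of_lt_of_le h.1.2 hg) (not_lt.mpr h.1.1)
    rw [hw0] at hb
    omega
  · have hmin : min g j = j := min_eq_right hg
    rw [hmin] at hb
    omega

/-- **LAW (inside).** for `i ≤ g ≤ j` the address is NEGATED mod 3 — in particular `0 ↦ 0`, `{1,2} ↦ {2,1}`. -/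
theorem addr_segCompl_inside (c : ℕ) (u : Fin n → Bool) {i j : ℕ} (hij : i ≤ j) (hj : j ≤ n)
    (hzi : addr c u i = 0) (hzj : addr c u j = 0) {g : ℕ} (hg : i ≤ g ∧ g ≤ j) :
    addr c (segCompl u i j) g = (2 * addr c u g) % 3 := by
  have hb := walkExp_segCompl u (i := i) hj g
  have hw := walkExp_add_wseg u hij
  have hwg := walkExp_add_wseg u hg.1
  unfold addr at *
  have hmin : min g j = g := min_eq_left hg.2
  rw [hmin] at hb
  omega

/-- **LAW (liveness).** under a zero-to-zero segment complement EVERY cut keeps its liveness. -/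
theorem live_segCompl_iff (c : ℕ) (u : Fin n → Bool) {i j : ℕ} (hij : i ≤ j) (hj : j ≤ n)
    (hzi : addr c u i = 0) (hzj : addr c u j = 0) (g : ℕ) :
    addr c (segCompl u i j) g ≠ 0 ↔ addr c u g ≠ 0 := by
  by_cases h1 : g ≤ i
  · rw [addr_segCompl_outside c u hij hj hzi hzj (Or.inl h1)]
  · by_cases h2 : j ≤ g
    · rw [addr_segCompl_outside c u hij hj hzi hzj (Or.inr h2)]
    · rw [addr_segCompl_inside c u hij hj hzi hzj ⟨(not_le.mp h1).le, (not_le.mp h2).le⟩]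
      have : addr c u g < 3 := Nat.mod_lt _ (by norm_num)
      unfold addr at *
      omega

/-- the zero set itself is invariant (so moves compose: the orbit of `u` is `{0,1}^{#zeros − 1}`). -/
theorem zero_segCompl_iff (c : ℕ) (u : Fin n → Bool) {i j : ℕ} (hij : i ≤ j) (hj : j ≤ n)
    (hzi : addr c u i = 0) (hzj : addr c u j = 0) (g : ℕ) :
    addr c (segCompl u i j) g = 0 ↔ addr c u g = 0 := by
  have := live_segCompl_iff c u hij hj hzi hzj g
  tauto

/-- fired-and-live count: `ringWinU c y u = decide (flc c y u % 2 = 1)` by `rfl`. -/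
def flc (c : ℕ) (y : Fin (n + 1) → (Fin n → Bool) → Bool) (u : Fin n → Bool) : ℕ :=
  (univ.filter fun g : Fin (n + 1) => y g u = true ∧ (c + g.val + walkExp u g.val) % 3 ≠ 0).card

/-- `ringWinU` is the parity of the fired-live count (`rfl`). -/
theorem ringWinU_eq_decide (c : ℕ) (y : Fin (n + 1) → (Fin n → Bool) → Bool) (u : Fin n → Bool) :
    ringWinU c y u = decide (flc c y u % 2 = 1) := rfl

/-- the number of LIVE cuts whose output differs between `u` and `v` (liveness read on `u`). -/
def liveDiff (c : ℕ) (y : Fin (n + 1) → (Fin n → Bool) → Bool) (u v : Fin n → Bool) : ℕ :=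
  (univ.filter fun g : Fin (n + 1) => (c + g.val + walkExp u g.val) % 3 ≠ 0 ∧ y g v ≠ y g u).card

/-- **LAW (XOR-difference identity).** if `u` and `v` have the same liveness vector then the fired-live counts of `u` and `v`
differ, mod 2, by the number of live cuts whose output differs. -/
theorem flc_add_flc_mod_two (c : ℕ) (y : Fin (n + 1) → (Fin n → Bool) → Bool) (u v : Fin n → Bool)
    (hlive : ∀ g : Fin (n + 1), (c + g.val + walkExp v g.val) % 3 ≠ 0 ↔ (c + g.val + walkExp u g.val) % 3 ≠ 0) :
    (flc c y v + flc c y u) % 2 = liveDiff c y u v % 2 := by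
  unfold flc liveDiff
  rw [card_filter, card_filter, card_filter, ← sum_add_distrib, Finset.sum_nat_mod, Finset.sum_nat_mod (s := univ)
    (f := fun g : Fin (n + 1) => if (c + g.val + walkExp u g.val) % 3 ≠ 0 ∧ y g v ≠ y g u then 1 else 0)]
  congr 1
  refine sum_congr rfl fun g _ => ?_
  simp only [hlive g]
  by_cases hl : (c + g.val + walkExp u g.val) % 3 ≠ 0
  · cases hv : y g v <;> cases hu : y g u <;> simp [hl]
  · simp [hl]

/-- **LAW (win bit under a move).** for a zero-to-zero segment complement, the win bit is unchanged iff an EVEN number of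
live cuts change their output; it flips iff an ODD number do. -/
theorem ringWinU_segCompl_iff (c : ℕ) (y : Fin (n + 1) → (Fin n → Bool) → Bool) (u : Fin n → Bool) {i j : ℕ}
    (hij : i ≤ j) (hj : j ≤ n) (hzi : addr c u i = 0) (hzj : addr c u j = 0) :
    (ringWinU c y (segCompl u i j) = ringWinU c y u) ↔ liveDiff c y u (segCompl u i j) % 2 = 0 := by
  have h := flc_add_flc_mod_two c y u (segCompl u i j)
    (fun g => live_segCompl_iff c u hij hj hzi hzj g.val)
  rw [ringWinU_eq_decide, ringWinU_eq_decide]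
  have h1 : flc c y (segCompl u i j) % 2 < 2 := Nat.mod_lt _ (by norm_num)
  have h2 : flc c y u % 2 < 2 := Nat.mod_lt _ (by norm_num)
  constructor
  · intro heq
    have : (flc c y (segCompl u i j) % 2 = 1) ↔ (flc c y u % 2 = 1) := by
      simpa using congrArg (fun b => b = true) heq
    omega
  · intro h0
    have : (flc c y (segCompl u i j) % 2 = 1) ↔ (flc c y u % 2 = 1) := by omega
    by_cases hh : flc c y u % 2 = 1
    · rw [decide_eq_true hh, decide_eq_true (this.mpr hh)]
    · rw [decide_eq_false hh, decide_eq_false (fun h' => hh (this.mp h'))]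

/-- corollary: an ODD number of changed live outputs ⇒ exactly one of `u`, `segCompl u i j` wins. -/
theorem ringWinU_segCompl_ne (c : ℕ) (y : Fin (n + 1) → (Fin n → Bool) → Bool) (u : Fin n → Bool) {i j : ℕ}
    (hij : i ≤ j) (hj : j ≤ n) (hzi : addr c u i = 0) (hzj : addr c u j = 0)
    (hodd : liveDiff c y u (segCompl u i j) % 2 = 1) :
    ringWinU c y (segCompl u i j) ≠ ringWinU c y u := by
  intro h
  have := (ringWinU_segCompl_iff c y u hij hj hzi hzj).mp h
  omega

/-! ### LAW: the abstract pairing law -/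

/-- **PAIRING LAW.** If `M` maps a set `E` of inputs to itself, is an involution on `E`, and flips the win bit on `E`,
then at least `|E|/2` inputs lose: `2·#WIN + |E| ≤ 2·2ⁿ`. -/
theorem pairing_law (c : ℕ) (y : Fin (n + 1) → (Fin n → Bool) → Bool) (E : Finset (Fin n → Bool))
    (M : (Fin n → Bool) → (Fin n → Bool)) (hME : ∀ u ∈ E, M u ∈ E) (hMM : ∀ u ∈ E, M (M u) = u)
    (hflip : ∀ u ∈ E, ringWinU c y (M u) ≠ ringWinU c y u) :
    2 * (univ.filter fun u : Fin n → Bool => ringWinU c y u = true).card + E.card ≤ 2 * 2 ^ n := by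
  classical
  set W := univ.filter fun u : Fin n → Bool => ringWinU c y u = true with hW
  set EW := E.filter fun u => ringWinU c y u = true with hEW
  set EL := E.filter fun u => ¬ ringWinU c y u = true with hEL
  have hsplit : EW.card + EL.card = E.card := by
    rw [hEW, hEL]; exact card_filter_add_card_filter_not _
  -- `M` is a bijection `EW → EL`
  have hbij : EW.card = EL.card := by
    refine le_antisymm ?_ ?_
    · refine card_le_card_of_injOn M (fun u hu => ?_) (fun u hu v hv huv => ?_)
      · rw [hEW, mem_coe, mem_filter] at hu
        rw [hEL, mem_coe, mem_filter]
        refine ⟨hME u hu.1, fun h => hflip u hu.1 ?_⟩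
        rw [h, hu.2]
      · rw [hEW, mem_coe, mem_filter] at hu hv
        have := congrArg M huv
        rwa [hMM u hu.1, hMM v hv.1] at this
    · refine card_le_card_of_injOn M (fun u hu => ?_) (fun u hu v hv huv => ?_)
      · rw [hEL, mem_coe, mem_filter] at hu
        rw [hEW, mem_coe, mem_filter]
        refine ⟨hME u hu.1, ?_⟩
        cases h1 : ringWinU c y (M u)
        · exfalso
          cases h2 : ringWinU c y u
          · exact hflip u hu.1 (by rw [h1, h2])
          · exact hu.2 h2
        · rfl
      · rw [hEL, mem_coe, mem_filter] at hu hv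
        have := congrArg M huv
        rwa [hMM u hu.1, hMM v hv.1] at this
  -- winners avoid `EL`
  have hWsub : W ⊆ univ \ EL := by
    intro u hu
    rw [hW, mem_filter] at hu
    rw [mem_sdiff, hEL, mem_filter]
    exact ⟨mem_univ _, fun h => h.2 hu.2⟩
  have hWcard : W.card + EL.card ≤ 2 ^ n := by
    have h1 := card_le_card hWsub
    rw [card_sdiff_of_subset (subset_univ _), card_univ, Fintype.card_fun, Fintype.card_bool, Fintype.card_fin] at h1
    have h2 : EL.card ≤ 2 ^ n := by
      calc EL.card ≤ (univ : Finset (Fin n → Bool)).card := card_le_univ _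
        _ = 2 ^ n := by rw [card_univ, Fintype.card_fun, Fintype.card_bool, Fintype.card_fin]
    omega
  omega

end Summit.QuantumAdvantage.AdviceFreeQNC0.JLinPeel.SegMove
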